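import Summits.HodgeConjecture.HodgeConjecture.Theorems.F0P3cStCharTSEllInnerTorusExchange   -- ★ (E0a) p852611 (this seat): `sum_invIndex_mul_integral_ncard_mul_eq_integral_comp`, `ncard_setOf_isConj_apply_eq_{zero_of_ne,index}`, `exists_conj_continuousMulEquiv`
import Summits.HodgeConjecture.HodgeConjecture.Theorems.F0P3cStCharTSUpTrClaimP              -- ★ (P3) p852453: brings ★ (N5) `StableFibre.weighted_fibre_sum_eq`, ★ (H6-T), ★ UP-EVAL `exists_finset_normFibre`, ★ (H3b) CARTAN-FIELDS-H, `isLocalGRegular_of_isConj`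
import Literature.GroupTheory.StableFibreDensityOne                                          -- ★ (E0-count) (F0P3a-p06 (g23)): `StableFibre.weighted_fibre_card_eq_one`
import Literature.NumberTheory.Rogawski1990.LocalEndoscopicTorusTransport                   -- ★ (Θ): `exists_localEndoCentralizerEquiv_normPair` (compactness of centralisers across norm pairs)
import HarnessLib

/-!
# F0 · P3c · line LH6 «StCharTS» — road «ELL-INNER», brick (E0) «G-REGROUP»: the elliptic torus sum `Σ_{T′ ∈ Sell} |W_G(T′)|⁻¹ ∫_{T′} Φ` of a class function,
# re-parametrised by the `H_v`-Cartan system and the embedding family (Rogawski 1990 §12.5 pp. 182–184; the continuous `G`-side twin of ★ (N5))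

Cell `pub/hodgecm-mathlib`, crux H413 = `stmt-HodgeConjecture-24833` (lane `--supports … --as helper`, count-neutral), route HCCMUnconditional; seat LH6-p03 (g7), «ELL-INNER» map owner
(LEAD F0P3a-plan (g15) T14-40 ∕ T14-44).  THEOREMS ONLY (no definition ∕ instance ∕ notation ∕ named fact ∕ `sorry`); ★-only imports; axioms TRIO.

THE MATHEMATICS (census `F0/P3b/LH6-p03/g7/CENSUS-1252-ELL-INNER.v1.LH6p03g7.md`, sigsheet `E0-GRegroup.sigsheet.v1`).  `G = U(Φ₃)(L⁺_v)`, `H_v = U(Φ₂) × U(Φ₁)`, `v` non-split.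
`Sell` = the elliptic `G`-Cartan representatives with their core-one Haar measures `μTf` (★ RUNG0 v8 `hBlock′` letters `hcartO`, `hncGO`↾`Sell`, `hHaarGO`, `hcoreGO`); `SH` = the compact
`H_v`-Cartan representatives (`hZ`, `hKH`, `hcomplete` for `G`-regular elements with COMPACT centraliser, `hirred`) with Haar measures `tH` of mass one on the compact core (★ (A1′)-E
letters); the embedding family `eT T i : T ≃ₜ* Z_G(γc T i)` with `ψ`, `fib`, `hψR`, `hψuniq` (★ (X2)∕(P3) letters) and the members `T₀(T,i) ∈ Sell` they land in (`hcovE`); the class counts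
`m` (★ (H6a′)); the fibre count `cQ` (T14-40 (α): a THEOREM-LEVEL letter, discharged by (E2) FIBRE-ENUM — `3` on type (1), `1` on type (2)).  For every conjugation-invariant
measurable `Φ : G → ℂ` vanishing off the classes matched from `G`-regular elements of `H_v` and integrable on every `T′ ∈ Sell` (the GIVEN total integrand — fence (γ)):
  `Σ_{T′ ∈ Sell} ([N_G(T′):T′])⁻¹ ∫_{T′} Φ dμTf T′ = Σ_{T ∈ SH} ([N_H(T):T])⁻¹ (m T)⁻¹ (cQ T)⁻¹ Σ_{i} ∫_{s ∈ T, G-regular} Φ(eT T i s) dtH T`   (`ellipticTorusSum_eq_weightedSum_embedding`)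
and the TRANSPORT COMPANION `integrableOn_comp_embedding` (each `Φ ∘ eT T i` is integrable on `T^{G-reg}` — DERIVED from the total by whole-measure transport, never assumed).
PROOF.  Pointwise at `x ∈ T′`: `Φ x = Σ_{T,i} ([N_H(T):T])⁻¹ (m T)⁻¹ (cQ T)⁻¹ · #{s ∈ T ∣ eT T i s ∼ x} · Φ x` — trivial where `Φ x = 0` (non-regular or unmatched `x`), and ★ (E0-count)
`weighted_fibre_card_eq_one` (★ (N5) at the constant stable function) at the `G`-regular norm fibre of a matched regular `x` (its members have COMPACT centralisers — ★ (Θ) across the norm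
pair — so the compact system `SH` is complete for them); then `Σ_{T′}` ∕ `Σ_{T,i}` exchange (each piece is a constant multiple of `Φ` on `T′`, ★ (E0a) §2) and ★ (E0a) per `(T, i)`.
WEIGHTS (checked against print on both torus types, census ∕ T14-40 (β)): `([N_H(T):T])⁻¹(m T)⁻¹(cQ T)⁻¹` per `(T,i)` reproduces `|W_G(T′)|⁻¹` per `G`-class of tori.
HONEST LABEL: count-neutral helper; closes no organ; `𝔇.Prop1252` stays a PRINTED consequent of `hBlock′` until the road's ★ rider; HC_CM is proved only modulo the 7 printed citations
(2 remaining named inputs: hLiu418 = `stmt-HodgeConjecture-24832`, h413 = `stmt-HodgeConjecture-24833`) until rung 0 closes.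

## References
* [Rogawski1990] J. D. Rogawski, *Automorphic Representations of Unitary Groups in Three Variables*, Ann. of Math. Stud. 123 (1990): §12.5 pp. 182–184 (p. 182 the `δ`-count, p. 184 the
  first display, Prop. 12.5.2); §3.6 L. 3.6.1 p. 28; §3.7 Prop. 3.7.1 p. 29.
* [LanglandsShelstad1987] R. P. Langlands, D. Shelstad, *On the definition of transfer factors*, Math. Ann. 278 (1987), §1.3.
* [HarishChandra1970] Harish-Chandra (notes by G. van Dijk), *Harmonic analysis on reductive p-adic groups*, LNM 162 (1970), Part V §4 Lemma 42.
-/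

set_option autoImplicit false
set_option linter.dupNamespace false

noncomputable section

open MeasureTheory Measure Set Function NumberField IsDedekindDomain Matrix
open Literature.NumberTheory.Automorphic Literature.NumberTheory.Automorphic.UnitaryGroup Literature.NumberTheory.Rogawski1990
open Literature.NumberTheory.GaloisRepresentations
open Summit.HodgeConjecture.HodgeConjecture.Cruxes.H413
open Summit.HodgeConjecture.HodgeConjecture.Cruxes.H413.F0P3cStCharTSWeylCartanRadial
open Summit.HodgeConjecture.HodgeConjecture.Cruxes.H413.F0P3cStCharTSEllInnerTorusExchange
open Summit.HodgeConjecture.HodgeConjecture.Cruxes.H413.F0P3cStCharTSUpTrExchange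
open Summit.HodgeConjecture.HodgeConjecture.Cruxes.H413.F0P3cStCharTSUpTrClaimP
open Summit.HodgeConjecture.HodgeConjecture.Cruxes.H413.F0P3cStCharTSUpEval
open scoped MatrixGroups Classical

namespace Summit.HodgeConjecture.HodgeConjecture.Cruxes.H413.F0P3cStCharTSEllInnerGRegroup

variable (L : Type) [Field L] [NumberField L] [IsCMField L] (v : HeightOneSpectrum (𝓞 ↥(maximalRealSubfield L)))

/-! ## §1 Compact centralisers across stable conjugacy ∕ norm pairs; transversals of a norm fibre -/

/-- **A `G`-regular element stably conjugate to one with compact centraliser has compact centraliser** — both centralisers are isomorphic, as topological groups, to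
`Z_G(ι_v a)` (★ (Θ) at the norm pairs `a ↔ ι_v a`, `b ↔ ι_v a`). [cite: Rogawski1990, §3.1 p. 19; §12.5 p. 184] [cite: LanglandsShelstad1987, §1.3] -/
theorem isCompact_centralizer_of_isLocalStablyConjH {a b : ((UnitaryGroup.cmDatum L 2 (Matrix.of fun i j : Fin 2 => if i.val + j.val + 1 = 2 then (1 : L) else 0)).Local v × (UnitaryGroup.cmDatum L 1 (Matrix.of fun i j : Fin 1 => if i.val + j.val + 1 = 1 then (1 : L) else 0)).Local v)} (ha : IsLocalGRegular L v a)
    (hac : IsCompact ((Subgroup.centralizer ({a} : Set ((UnitaryGroup.cmDatum L 2 (Matrix.of fun i j : Fin 2 => if i.val + j.val + 1 = 2 then (1 : L) else 0)).Local v × (UnitaryGroup.cmDatum L 1 (Matrix.of fun i j : Fin 1 => if i.val + j.val + 1 = 1 then (1 : L) else 0)).Local v)) : Subgroup ((UnitaryGroup.cmDatum L 2 (Matrix.of fun i j : Fin 2 => if i.val + j.val + 1 = 2 then (1 : L) else 0)).Local v × (UnitaryGroup.cmDatum L 1 (Matrix.of fun i j : Fin 1 => if i.val + j.val + 1 = 1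 then (1 : L) else 0)).Local v)) : Set ((UnitaryGroup.cmDatum L 2 (Matrix.of fun i j : Fin 2 => if i.val + j.val + 1 = 2 then (1 : L) else 0)).Local v × (UnitaryGroup.cmDatum L 1 (Matrix.of fun i j : Fin 1 => if i.val + j.val + 1 = 1 then (1 : L) else 0)).Local v))) (hab : IsLocalStablyConjH L v a b) :
    IsCompact ((Subgroup.centralizer ({b} : Set ((UnitaryGroup.cmDatum L 2 (Matrix.of fun i j : Fin 2 => if i.val + j.val + 1 = 2 then (1 : L) else 0)).Local v × (UnitaryGroup.cmDatum L 1 (Matrix.of fun i j : Fin 1 => if i.val + j.val + 1 = 1 then (1 : L) else 0)).Local v)) : Subgroup ((UnitaryGroup.cmDatum L 2 (Matrix.of fun i j : Fin 2 => if i.val + j.val + 1 = 2 then (1 : L) else 0)).Local v × (UnitaryGroup.cmDatum L 1 (Matrix.of fun i j : Fin 1 => if i.val + j.val + 1 = 1 then (1 : L) else 0)).Local v)) : Set ((UnitaryGroup.cmDatum L 2 (Matrix.of fun i j : Fin 2 => if i.val + j.val + 1 = 2 then (1 : L) else 0)).Local v × (UnitaryGroup.cmDatum L 1 (Matrix.of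 fun i j : Fin 1 => if i.val + j.val + 1 = 1 then (1 : L) else 0)).Local v)) := by
  have hma : IsLocalNormPair L (qsForm L) v a (endoEmbLocal L v a) := IsConj.refl _
  have hmb : IsLocalNormPair L (qsForm L) v b (endoEmbLocal L v a) := (isLocalNormPair_iff_of_isLocalStablyConjH L v (qsForm L) hab _).2 hma
  have hb : IsLocalGRegular L v b := isLocalGRegular_of_isLocalStablyConjH L v ha hab
  obtain ⟨ea, -, -, -⟩ := exists_localEndoCentralizerEquiv_normPair L v (UnitaryGroup.isUnit_antidiagOne_det L 3).ne_zero ha hma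
  obtain ⟨eb, -, -, -⟩ := exists_localEndoCentralizerEquiv_normPair L v (UnitaryGroup.isUnit_antidiagOne_det L 3).ne_zero hb hmb
  haveI : CompactSpace ↥(Subgroup.centralizer ({a} : Set ((UnitaryGroup.cmDatum L 2 (Matrix.of fun i j : Fin 2 => if i.val + j.val + 1 = 2 then (1 : L) else 0)).Local v × (UnitaryGroup.cmDatum L 1 (Matrix.of fun i j : Fin 1 => if i.val + j.val + 1 = 1 then (1 : L) else 0)).Local v))) := isCompact_iff_compactSpace.1 hac
  haveI : CompactSpace ↥(Subgroup.centralizer ({endoEmbLocal L v a} : Set (Gqs L v))) := ea.toHomeomorph.compactSpace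
  haveI : CompactSpace ↥(Subgroup.centralizer ({b} : Set ((UnitaryGroup.cmDatum L 2 (Matrix.of fun i j : Fin 2 => if i.val + j.val + 1 = 2 then (1 : L) else 0)).Local v × (UnitaryGroup.cmDatum L 1 (Matrix.of fun i j : Fin 1 => if i.val + j.val + 1 = 1 then (1 : L) else 0)).Local v))) := eb.symm.toHomeomorph.compactSpace
  exact isCompact_iff_compactSpace.2 inferInstance

/-- **A `G`-regular norm partner of an element with compact centraliser has compact centraliser** (★ (Θ) at the pair itself). [cite: Rogawski1990, §12.5 p. 184] [cite: LanglandsShelstad1987, §1.3] -/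
theorem isCompact_centralizer_of_isLocalNormPair {q : ((UnitaryGroup.cmDatum L 2 (Matrix.of fun i j : Fin 2 => if i.val + j.val + 1 = 2 then (1 : L) else 0)).Local v × (UnitaryGroup.cmDatum L 1 (Matrix.of fun i j : Fin 1 => if i.val + j.val + 1 = 1 then (1 : L) else 0)).Local v)} {x : Gqs L v} (hq : IsLocalGRegular L v q) (hqx : IsLocalNormPair L (qsForm L) v q x)
    (hxc : IsCompact ((Subgroup.centralizer ({x} : Set (Gqs L v)) : Subgroup (Gqs L v)) : Set (Gqs L v))) :
    IsCompact ((Subgroup.centralizer ({q} : Set ((UnitaryGroup.cmDatum L 2 (Matrix.of fun i j : Fin 2 => if i.val + j.val + 1 = 2 then (1 : L) else 0)).Local v × (UnitaryGroup.cmDatum L 1 (Matrix.of fun i j : Fin 1 => if i.val + j.val + 1 = 1 then (1 : L) else 0)).Local v)) : Subgroup ((UnitaryGroup.cmDatum L 2 (Matrix.of fun i j : Fin 2 => if i.val + j.val + 1 = 2 then (1 : L) else 0)).Local v × (UnitaryGroup.cmDatum L 1 (Matrix.of fun i j : Fin 1 => if i.val + j.val + 1 = 1 then (1 : L) else 0)).Local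 v)) : Set ((UnitaryGroup.cmDatum L 2 (Matrix.of fun i j : Fin 2 => if i.val + j.val + 1 = 2 then (1 : L) else 0)).Local v × (UnitaryGroup.cmDatum L 1 (Matrix.of fun i j : Fin 1 => if i.val + j.val + 1 = 1 then (1 : L) else 0)).Local v)) := by
  obtain ⟨e, -, -, -⟩ := exists_localEndoCentralizerEquiv_normPair L v (UnitaryGroup.isUnit_antidiagOne_det L 3).ne_zero hq hqx
  haveI : CompactSpace ↥(Subgroup.centralizer ({x} : Set (Gqs L v))) := isCompact_iff_compactSpace.1 hxc
  haveI : CompactSpace ↥(Subgroup.centralizer ({q} : Set ((UnitaryGroup.cmDatum L 2 (Matrix.of fun i j : Fin 2 => if i.val + j.val + 1 = 2 then (1 : L) else 0)).Local v × (UnitaryGroup.cmDatum L 1 (Matrix.of fun i j : Fin 1 => if i.val + j.val + 1 = 1 then (1 : L) else 0)).Local v))) := e.symm.toHomeomorph.compactSpace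
  exact isCompact_iff_compactSpace.2 inferInstance

/-- Two finite transversals, by stable conjugacy, of the same `G`-regular norm fibre have the same cardinality. [cite: LanglandsShelstad1987, §1.3] -/
theorem card_eq_of_normFibre_transversals {x : Gqs L v} {Q Q' : Finset ((UnitaryGroup.cmDatum L 2 (Matrix.of fun i j : Fin 2 => if i.val + j.val + 1 = 2 then (1 : L) else 0)).Local v × (UnitaryGroup.cmDatum L 1 (Matrix.of fun i j : Fin 1 => if i.val + j.val + 1 = 1 then (1 : L) else 0)).Local v)}
    (hQ : ∀ q ∈ Q, IsLocalGRegular L v q ∧ IsLocalNormPair L (qsForm L) v q x) (hQinj : ∀ q ∈ Q, ∀ q' ∈ Q, IsLocalStablyConjH L v q q' → q = q')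
    (hQexh : ∀ a : ((UnitaryGroup.cmDatum L 2 (Matrix.of fun i j : Fin 2 => if i.val + j.val + 1 = 2 then (1 : L) else 0)).Local v × (UnitaryGroup.cmDatum L 1 (Matrix.of fun i j : Fin 1 => if i.val + j.val + 1 = 1 then (1 : L) else 0)).Local v), IsLocalGRegular L v a → IsLocalNormPair L (qsForm L) v a x → ∃ q ∈ Q, IsLocalStablyConjH L v a q)
    (hQ' : ∀ q ∈ Q', IsLocalGRegular L v q ∧ IsLocalNormPair L (qsForm L) v q x) (hQ'inj : ∀ q ∈ Q', ∀ q' ∈ Q', IsLocalStablyConjH L v q q' → q = q')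
    (hQ'exh : ∀ a : ((UnitaryGroup.cmDatum L 2 (Matrix.of fun i j : Fin 2 => if i.val + j.val + 1 = 2 then (1 : L) else 0)).Local v × (UnitaryGroup.cmDatum L 1 (Matrix.of fun i j : Fin 1 => if i.val + j.val + 1 = 1 then (1 : L) else 0)).Local v), IsLocalGRegular L v a → IsLocalNormPair L (qsForm L) v a x → ∃ q ∈ Q', IsLocalStablyConjH L v a q) :
    Q.card = Q'.card := by
  have key : ∀ q ∈ Q, ∃ q' ∈ Q', IsLocalStablyConjH L v q q' := fun q hq => hQ'exh q (hQ q hq).1 (hQ q hq).2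
  choose! φ hφmem hφst using key
  refine Finset.card_bij (fun q _ => φ q) (fun q hq => hφmem q hq) (fun q₁ h₁ q₂ h₂ h => ?_) (fun q' hq' => ?_)
  · exact hQinj q₁ h₁ q₂ h₂ ((hφst q₁ h₁).trans (h ▸ (hφst q₂ h₂).symm))
  · obtain ⟨q, hq, hqq'⟩ := hQexh q' (hQ' q' hq').1 (hQ' q' hq').2
    exact ⟨q, hq, hQ'inj _ (hφmem q hq) _ hq' ((hφst q hq).symm.trans hqq'.symm)⟩

/-! ## §2 The letters of the road and the pointwise density -/

section Road

variable
    (hns : ∀ w : PlacesOver L v, IsCMField.complexConj L • w.1 = w.1)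
    [MeasurableSpace (Gqs L v)] [BorelSpace (Gqs L v)] [LocallyCompactSpace (Gqs L v)] [SecondCountableTopology (Gqs L v)] [T2Space (Gqs L v)]
    [IsTopologicalGroup (Gqs L v)]
    [MeasurableSpace ((UnitaryGroup.cmDatum L 2 (Matrix.of fun i j : Fin 2 => if i.val + j.val + 1 = 2 then (1 : L) else 0)).Local v × (UnitaryGroup.cmDatum L 1 (Matrix.of fun i j : Fin 1 => if i.val + j.val + 1 = 1 then (1 : L) else 0)).Local v)] [BorelSpace ((UnitaryGroup.cmDatum L 2 (Matrix.of fun i j : Fin 2 => if i.val + j.val + 1 = 2 then (1 : L) else 0)).Local v × (UnitaryGroup.cmDatum L 1 (Matrix.of fun i j : Fin 1 => if i.val + j.val + 1 = 1 then (1 : L) else 0)).Local v)]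
    -- the `H`-side compact Cartan system with embeddings and core-one Haar measures (★ (A1′)-E ∕ (P3) letters BY SHAPE; `hcomplete` for COMPACT centralisers = ★ R8 `hcovHO`'s scope)
    (SH : Finset (Subgroup ((UnitaryGroup.cmDatum L 2 (Matrix.of fun i j : Fin 2 => if i.val + j.val + 1 = 2 then (1 : L) else 0)).Local v × (UnitaryGroup.cmDatum L 1 (Matrix.of fun i j : Fin 1 => if i.val + j.val + 1 = 1 then (1 : L) else 0)).Local v))) (n : Subgroup ((UnitaryGroup.cmDatum L 2 (Matrix.of fun i j : Fin 2 => if i.val + j.val + 1 = 2 then (1 : L) else 0)).Local v × (UnitaryGroup.cmDatum L 1 (Matrix.of fun i j : Fin 1 => if i.val + j.val + 1 = 1 then (1 : L) else 0)).Local v) → ℕ)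
    (γc : (T : Subgroup ((UnitaryGroup.cmDatum L 2 (Matrix.of fun i j : Fin 2 => if i.val + j.val + 1 = 2 then (1 : L) else 0)).Local v × (UnitaryGroup.cmDatum L 1 (Matrix.of fun i j : Fin 1 => if i.val + j.val + 1 = 1 then (1 : L) else 0)).Local v)) → Fin (n T) → Gqs L v) (hγc : ∀ T ∈ SH, ∀ i : Fin (n T), IsRegularElt ((γc T i).val : GL (Fin 3) (UnitaryGroup.LocalRing L v)))
    (eT : (T : Subgroup ((UnitaryGroup.cmDatum L 2 (Matrix.of fun i j : Fin 2 => if i.val + j.val + 1 = 2 then (1 : L) else 0)).Local v × (UnitaryGroup.cmDatum L 1 (Matrix.of fun i j : Fin 1 => if i.val + j.val + 1 = 1 then (1 : L) else 0)).Local v)) → (i : Fin (n T)) → (↥T ≃ₜ* ↥(Subgroup.centralizer ({γc T i} : Set (Gqs L v)))))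
    (heT : ∀ T ∈ SH, ∀ (i : Fin (n T)) (s : ↥T), IsLocalNormPair L (qsForm L) v s.1 ((eT T i s : ↥(Subgroup.centralizer ({γc T i} : Set (Gqs L v)))) : Gqs L v))
    (ψ : (T : Subgroup ((UnitaryGroup.cmDatum L 2 (Matrix.of fun i j : Fin 2 => if i.val + j.val + 1 = 2 then (1 : L) else 0)).Local v × (UnitaryGroup.cmDatum L 1 (Matrix.of fun i j : Fin 1 => if i.val + j.val + 1 = 1 then (1 : L) else 0)).Local v)) → Fin (n T) → ((UnitaryGroup.cmDatum L 2 (Matrix.of fun i j : Fin 2 => if i.val + j.val + 1 = 2 then (1 : L) else 0)).Local v × (UnitaryGroup.cmDatum L 1 (Matrix.of fun i j : Fin 1 => if i.val + j.val + 1 = 1 then (1 : L) else 0)).Local v) → Gqs L v) (hψ : ∀ T ∈ SH, ∀ (i : Fin (n T)) (s : ↥T), ψ T i s.1 = ((eT T i s : ↥(Subgroup.centralizer ({γc T i} : Set (Gqs L v)))) : Gqs L v))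
    (fib : Gqs L v → (T : Subgroup ((UnitaryGroup.cmDatum L 2 (Matrix.of fun i j : Fin 2 => if i.val + j.val + 1 = 2 then (1 : L) else 0)).Local v × (UnitaryGroup.cmDatum L 1 (Matrix.of fun i j : Fin 1 => if i.val + j.val + 1 = 1 then (1 : L) else 0)).Local v)) → Fin (n T) → Finset ((UnitaryGroup.cmDatum L 2 (Matrix.of fun i j : Fin 2 => if i.val + j.val + 1 = 2 then (1 : L) else 0)).Local v × (UnitaryGroup.cmDatum L 1 (Matrix.of fun i j : Fin 1 => if i.val + j.val + 1 = 1 then (1 : L) else 0)).Local v))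
    (hfib : ∀ g : Gqs L v, ∀ T ∈ SH, ∀ (i : Fin (n T)) (x : ((UnitaryGroup.cmDatum L 2 (Matrix.of fun i j : Fin 2 => if i.val + j.val + 1 = 2 then (1 : L) else 0)).Local v × (UnitaryGroup.cmDatum L 1 (Matrix.of fun i j : Fin 1 => if i.val + j.val + 1 = 1 then (1 : L) else 0)).Local v)), x ∈ fib g T i ↔ x ∈ T ∧ IsLocalGRegular L v x ∧ IsConj (ψ T i x) g)
    (tH : (T : Subgroup ((UnitaryGroup.cmDatum L 2 (Matrix.of fun i j : Fin 2 => if i.val + j.val + 1 = 2 then (1 : L) else 0)).Local v × (UnitaryGroup.cmDatum L 1 (Matrix.of fun i j : Fin 1 => if i.val + j.val + 1 = 1 then (1 : L) else 0)).Local v)) → Measure ↥T) [∀ T, (tH T).IsHaarMeasure] (htH : ∀ T ∈ SH, tH T (compactCore ↥T) = 1)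
    (hZ : ∀ T ∈ SH, ∃ γ₀ : ((UnitaryGroup.cmDatum L 2 (Matrix.of fun i j : Fin 2 => if i.val + j.val + 1 = 2 then (1 : L) else 0)).Local v × (UnitaryGroup.cmDatum L 1 (Matrix.of fun i j : Fin 1 => if i.val + j.val + 1 = 1 then (1 : L) else 0)).Local v), IsLocalGRegular L v γ₀ ∧ T = Subgroup.centralizer ({γ₀} : Set ((UnitaryGroup.cmDatum L 2 (Matrix.of fun i j : Fin 2 => if i.val + j.val + 1 = 2 then (1 : L) else 0)).Local v × (UnitaryGroup.cmDatum L 1 (Matrix.of fun i j : Fin 1 => if i.val + j.val + 1 = 1 then (1 : L) else 0)).Local v)))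
    (hKH : ∀ T ∈ SH, IsCompact (T : Set ((UnitaryGroup.cmDatum L 2 (Matrix.of fun i j : Fin 2 => if i.val + j.val + 1 = 2 then (1 : L) else 0)).Local v × (UnitaryGroup.cmDatum L 1 (Matrix.of fun i j : Fin 1 => if i.val + j.val + 1 = 1 then (1 : L) else 0)).Local v)))
    (hcomplete : ∀ h : ((UnitaryGroup.cmDatum L 2 (Matrix.of fun i j : Fin 2 => if i.val + j.val + 1 = 2 then (1 : L) else 0)).Local v × (UnitaryGroup.cmDatum L 1 (Matrix.of fun i j : Fin 1 => if i.val + j.val + 1 = 1 then (1 : L) else 0)).Local v), IsLocalGRegular L v h → IsCompact ((Subgroup.centralizer ({h} : Set ((UnitaryGroup.cmDatum L 2 (Matrix.of fun i j : Fin 2 => if i.val + j.val + 1 = 2 then (1 : L) else 0)).Local v × (UnitaryGroup.cmDatum L 1 (Matrix.of fun i j : Fin 1 => if i.val + j.val + 1 = 1 then (1 : L) else 0)).Local v)) : Subgroup ((UnitaryGroup.cmDatum L 2 (Matrix.of fun i j : Fin 2 => if i.val + j.val + 1 = 2 then (1 : L) else 0)).Local v × (UnitaryGroup.cmDatum L 1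 (Matrix.of fun i j : Fin 1 => if i.val + j.val + 1 = 1 then (1 : L) else 0)).Local v)) : Set ((UnitaryGroup.cmDatum L 2 (Matrix.of fun i j : Fin 2 => if i.val + j.val + 1 = 2 then (1 : L) else 0)).Local v × (UnitaryGroup.cmDatum L 1 (Matrix.of fun i j : Fin 1 => if i.val + j.val + 1 = 1 then (1 : L) else 0)).Local v)) → ∃ T ∈ SH, ∃ s ∈ T, IsConj h s)
    (hirred : ∀ T ∈ SH, ∀ T' ∈ SH, ∀ s ∈ T, ∀ s' ∈ T', IsLocalGRegular L v s → IsConj s s' → T = T')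
    (m : Subgroup ((UnitaryGroup.cmDatum L 2 (Matrix.of fun i j : Fin 2 => if i.val + j.val + 1 = 2 then (1 : L) else 0)).Local v × (UnitaryGroup.cmDatum L 1 (Matrix.of fun i j : Fin 1 => if i.val + j.val + 1 = 1 then (1 : L) else 0)).Local v) → ℕ)
    (hclasses : ∀ T ∈ SH, ∀ s ∈ T, IsLocalGRegular L v s →
      ∃ C : Finset ((UnitaryGroup.cmDatum L 2 (Matrix.of fun i j : Fin 2 => if i.val + j.val + 1 = 2 then (1 : L) else 0)).Local v × (UnitaryGroup.cmDatum L 1 (Matrix.of fun i j : Fin 1 => if i.val + j.val + 1 = 1 then (1 : L) else 0)).Local v), (∀ x ∈ C, IsLocalStablyConjH L v s x) ∧ (∀ x ∈ C, ∀ y ∈ C, IsConj x y → x = y) ∧ (∀ y, IsLocalStablyConjH L v s y → ∃ x ∈ C, IsConj y x) ∧ C.card = m T)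
    (hψR : ∀ T ∈ SH, ∀ (i : Fin (n T)), ∀ s ∈ T, IsLocalGRegular L v s → IsLocalNormPair L (qsForm L) v s (ψ T i s))
    (hψuniq : ∀ T ∈ SH, ∀ s ∈ T, IsLocalGRegular L v s → ∀ g : Gqs L v, IsLocalNormPair L (qsForm L) v s g → ∃! i : Fin (n T), IsConj (ψ T i s) g)
    -- the fibre count (T14-40 (α): theorem-level letter, discharged by (E2) FIBRE-ENUM — `3` on type (1), `1` on type (2))
    (cQ : Subgroup ((UnitaryGroup.cmDatum L 2 (Matrix.of fun i j : Fin 2 => if i.val + j.val + 1 = 2 then (1 : L) else 0)).Local v × (UnitaryGroup.cmDatum L 1 (Matrix.of fun i j : Fin 1 => if i.val + j.val + 1 = 1 then (1 : L) else 0)).Local v) → ℕ)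
    (hcQ : ∀ T ∈ SH, ∀ (i : Fin (n T)) (s : ↥T), IsLocalGRegular L v s.1 →
      ∃ Q : Finset ((UnitaryGroup.cmDatum L 2 (Matrix.of fun i j : Fin 2 => if i.val + j.val + 1 = 2 then (1 : L) else 0)).Local v × (UnitaryGroup.cmDatum L 1 (Matrix.of fun i j : Fin 1 => if i.val + j.val + 1 = 1 then (1 : L) else 0)).Local v), (∀ q ∈ Q, IsLocalGRegular L v q ∧ IsLocalNormPair L (qsForm L) v q ((eT T i s : ↥(Subgroup.centralizer ({γc T i} : Set (Gqs L v)))) : Gqs L v)) ∧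
        (∀ q ∈ Q, ∀ q' ∈ Q, IsLocalStablyConjH L v q q' → q = q') ∧
        (∀ a : ((UnitaryGroup.cmDatum L 2 (Matrix.of fun i j : Fin 2 => if i.val + j.val + 1 = 2 then (1 : L) else 0)).Local v × (UnitaryGroup.cmDatum L 1 (Matrix.of fun i j : Fin 1 => if i.val + j.val + 1 = 1 then (1 : L) else 0)).Local v), IsLocalGRegular L v a → IsLocalNormPair L (qsForm L) v a ((eT T i s : ↥(Subgroup.centralizer ({γc T i} : Set (Gqs L v)))) : Gqs L v) → ∃ q ∈ Q, IsLocalStablyConjH L v a q) ∧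
        Q.card = cQ T)
    -- the `G`-side elliptic Cartan system (★ RUNG0 v8 `hBlock′` letters `hcartO`, `hncGO` restricted to `Sell`, `hHaarGO`, `hcoreGO`) and where the embeddings land (`hcovE`)
    (Sell : Finset (Subgroup (Gqs L v))) (μTf : (T' : Subgroup (Gqs L v)) → Measure ↥T')
    (hcartO : ∀ T ∈ Sell, IsCompact (T : Set (Gqs L v)) ∧
      ∃ γ₀ : Gqs L v, IsRegularElt (γ₀.val : GL (Fin 3) (UnitaryGroup.LocalRing L v)) ∧ T = Subgroup.centralizer ({γ₀} : Set (Gqs L v)))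
    (hncG : ∀ T' ∈ Sell, ∀ T'' ∈ Sell, T' ≠ T'' → ∀ y : Gqs L v, ¬ ∀ h : Gqs L v, h ∈ T'' ↔ y⁻¹ * h * y ∈ T')
    (hHaarGO : ∀ T ∈ Sell, (μTf T).IsHaarMeasure) (hcoreGO : ∀ T' ∈ Sell, μTf T' (compactCore ↥T') = 1)
    (hcovE : ∀ T ∈ SH, ∀ i : Fin (n T), ∃ T₀ ∈ Sell, ∃ y : Gqs L v,
      ∀ g : Gqs L v, g ∈ Subgroup.centralizer ({γc T i} : Set (Gqs L v)) ↔ y⁻¹ * g * y ∈ T₀)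
    -- the integrand
    (Φ : Gqs L v → ℂ) (hΦc : ∀ x z : Gqs L v, IsConj x z → Φ x = Φ z)
    (hΦ0 : ∀ x : Gqs L v, (¬ ∃ q : ((UnitaryGroup.cmDatum L 2 (Matrix.of fun i j : Fin 2 => if i.val + j.val + 1 = 2 then (1 : L) else 0)).Local v × (UnitaryGroup.cmDatum L 1 (Matrix.of fun i j : Fin 1 => if i.val + j.val + 1 = 1 then (1 : L) else 0)).Local v), IsLocalGRegular L v q ∧ IsLocalNormPair L (qsForm L) v q x) → Φ x = 0)
    (hΦi : ∀ T' ∈ Sell, Integrable (fun t : ↥T' => Φ (t : Gqs L v)) (μTf T'))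

omit [MeasurableSpace (Gqs L v)] [BorelSpace (Gqs L v)] [LocallyCompactSpace (Gqs L v)] [SecondCountableTopology (Gqs L v)] [T2Space (Gqs L v)]
  [IsTopologicalGroup (Gqs L v)] [MeasurableSpace ((UnitaryGroup.cmDatum L 2 (Matrix.of fun i j : Fin 2 => if i.val + j.val + 1 = 2 then (1 : L) else 0)).Local v × (UnitaryGroup.cmDatum L 1 (Matrix.of fun i j : Fin 1 => if i.val + j.val + 1 = 1 then (1 : L) else 0)).Local v)] [BorelSpace ((UnitaryGroup.cmDatum L 2 (Matrix.of fun i j : Fin 2 => if i.val + j.val + 1 = 2 then (1 : L) else 0)).Local v × (UnitaryGroup.cmDatum L 1 (Matrix.of fun i j : Fin 1 => if i.val + j.val + 1 = 1 then (1 : L) else 0)).Local v)] in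
include hΦ0 in
/-- `Φ` vanishes off the regular set (a `G`-regular norm partner forces regularity, ★ (A1′)-D). [cite: Rogawski1990, §12.5 p. 183] -/
theorem apply_eq_zero_of_not_isRegularElt (x : Gqs L v) (hx : ¬ IsRegularElt (x.val : GL (Fin 3) (UnitaryGroup.LocalRing L v))) : Φ x = 0 :=
  hΦ0 x fun ⟨_, hq, hqx⟩ => hx ((isLocalGRegular_iff_isRegularElt_of_isLocalNormPair L v hqx).1 hq)

omit [MeasurableSpace (Gqs L v)] [BorelSpace (Gqs L v)] [LocallyCompactSpace (Gqs L v)] [SecondCountableTopology (Gqs L v)] [T2Space (Gqs L v)]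
  [IsTopologicalGroup (Gqs L v)] [MeasurableSpace ((UnitaryGroup.cmDatum L 2 (Matrix.of fun i j : Fin 2 => if i.val + j.val + 1 = 2 then (1 : L) else 0)).Local v × (UnitaryGroup.cmDatum L 1 (Matrix.of fun i j : Fin 1 => if i.val + j.val + 1 = 1 then (1 : L) else 0)).Local v)] [BorelSpace ((UnitaryGroup.cmDatum L 2 (Matrix.of fun i j : Fin 2 => if i.val + j.val + 1 = 2 then (1 : L) else 0)).Local v × (UnitaryGroup.cmDatum L 1 (Matrix.of fun i j : Fin 1 => if i.val + j.val + 1 = 1 then (1 : L) else 0)).Local v)] in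
include heT hψ hfib in
/-- **The (E0a) count IS the (N5) fibre count**: at a regular `x`, `#{s ∈ T ∣ eT T i s ∼ x} = #fib x T i` (the `G`-regularity clause of `fib` is automatic for a conjugate of the regular
`x`, and `ψ T i = eT T i` on `T`). [cite: Rogawski1990, §12.5 pp. 182–183] -/
theorem ncard_eq_card_fib {T : Subgroup ((UnitaryGroup.cmDatum L 2 (Matrix.of fun i j : Fin 2 => if i.val + j.val + 1 = 2 then (1 : L) else 0)).Local v × (UnitaryGroup.cmDatum L 1 (Matrix.of fun i j : Fin 1 => if i.val + j.val + 1 = 1 then (1 : L) else 0)).Local v)} (hT : T ∈ SH) (i : Fin (n T)) (x : Gqs L v) (hx : IsRegularElt (x.val : GL (Fin 3) (UnitaryGroup.LocalRing L v))) :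
    {s : ↥T | IsConj ((eT T i s : ↥(Subgroup.centralizer ({γc T i} : Set (Gqs L v)))) : Gqs L v) x}.ncard = (fib x T i).card := by
  have himage : (Subtype.val : ↥T → ((UnitaryGroup.cmDatum L 2 (Matrix.of fun i j : Fin 2 => if i.val + j.val + 1 = 2 then (1 : L) else 0)).Local v × (UnitaryGroup.cmDatum L 1 (Matrix.of fun i j : Fin 1 => if i.val + j.val + 1 = 1 then (1 : L) else 0)).Local v)) '' {s : ↥T | IsConj ((eT T i s : ↥(Subgroup.centralizer ({γc T i} : Set (Gqs L v)))) : Gqs L v) x} = ↑(fib x T i) := by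
    ext a
    simp only [Set.mem_image, Set.mem_setOf_eq, Finset.mem_coe]
    constructor
    · rintro ⟨s, hs, rfl⟩
      refine (hfib x T hT i s.1).2 ⟨s.2, ?_, ?_⟩
      · have hreg : IsRegularElt ((((eT T i s : ↥(Subgroup.centralizer ({γc T i} : Set (Gqs L v)))) : Gqs L v)).val : GL (Fin 3) (UnitaryGroup.LocalRing L v)) := by
          obtain ⟨c, hc⟩ := isConj_iff.1 hs
          rw [← isRegularElt_conj_val_iff L v c, hc]; exact hx
        exact (isLocalGRegular_iff_isRegularElt_of_isLocalNormPair L v (heT T hT i s)).2 hreg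
      · rw [hψ T hT i s]; exact hs
    · intro ha
      obtain ⟨haT, -, hconj⟩ := (hfib x T hT i a).1 ha
      refine ⟨⟨a, haT⟩, ?_, rfl⟩
      have h := hψ T hT i ⟨a, haT⟩
      rw [← h]; exact hconj
  rw [← Set.ncard_coe_finset, ← himage, Set.ncard_image_of_injective _ Subtype.val_injective]

omit [MeasurableSpace (Gqs L v)] [BorelSpace (Gqs L v)] [LocallyCompactSpace (Gqs L v)] [SecondCountableTopology (Gqs L v)] [T2Space (Gqs L v)]
  [IsTopologicalGroup (Gqs L v)] [MeasurableSpace ((UnitaryGroup.cmDatum L 2 (Matrix.of fun i j : Fin 2 => if i.val + j.val + 1 = 2 then (1 : L) else 0)).Local v × (UnitaryGroup.cmDatum L 1 (Matrix.of fun i j : Fin 1 => if i.val + j.val + 1 = 1 then (1 : L) else 0)).Local v)] [BorelSpace ((UnitaryGroup.cmDatum L 2 (Matrix.of fun i j : Fin 2 => if i.val + j.val + 1 = 2 then (1 : L) else 0)).Local v × (UnitaryGroup.cmDatum L 1 (Matrix.of fun i j : Fin 1 => if i.val + j.val + 1 = 1 then (1 : L) else 0)).Local v)] in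
include hns heT hψ hfib hZ hKH hcomplete hirred hclasses hψR hψuniq hcQ in
/-- **THE WEIGHTED COUNT IS ONE at a matched regular `x` with compact centraliser** — ★ (E0-count) `weighted_fibre_card_eq_one` at the `G`-regular norm fibre of `x`, on which the
compact system `SH` is complete because every member of the fibre has compact centraliser (★ (Θ) across the pair `q ↔ x`); the count letter `cQ T` reads the fibre's size at every
`(T, i)` meeting it (two transversals of one fibre have the same size). [cite: Rogawski1990, §12.5 pp. 182–184] [cite: LanglandsShelstad1987, §1.3] -/
theorem sum_weight_mul_sum_ncard_eq_one (x : Gqs L v) (hx : IsRegularElt (x.val : GL (Fin 3) (UnitaryGroup.LocalRing L v)))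
    (hxc : IsCompact ((Subgroup.centralizer ({x} : Set (Gqs L v)) : Subgroup (Gqs L v)) : Set (Gqs L v)))
    (hmatch : ∃ q : ((UnitaryGroup.cmDatum L 2 (Matrix.of fun i j : Fin 2 => if i.val + j.val + 1 = 2 then (1 : L) else 0)).Local v × (UnitaryGroup.cmDatum L 1 (Matrix.of fun i j : Fin 1 => if i.val + j.val + 1 = 1 then (1 : L) else 0)).Local v), IsLocalGRegular L v q ∧ IsLocalNormPair L (qsForm L) v q x) :
    ∑ T ∈ SH, ((((T.subgroupOf (Subgroup.normalizer (T : Set ((UnitaryGroup.cmDatum L 2 (Matrix.of fun i j : Fin 2 => if i.val + j.val + 1 = 2 then (1 : L) else 0)).Local v × (UnitaryGroup.cmDatum L 1 (Matrix.of fun i j : Fin 1 => if i.val + j.val + 1 = 1 then (1 : L) else 0)).Local v)))).index : ℂ))⁻¹ * ((m T : ℂ))⁻¹ * ((cQ T : ℂ))⁻¹) * ∑ i : Fin (n T), (({s : ↥T | IsConj ((eT T i s : ↥(Subgroup.centralizer ({γc T i} : Set (Gqs L v)))) : Gqs L v) x}.ncard : ℂ)) = 1 := by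
  obtain ⟨q₀, hq₀, hq₀x⟩ := hmatch
  -- the transversal of the fibre (★ UP-EVAL ∕ (F1))
  obtain ⟨Q, hQ, hQpair, hQexh⟩ := exists_finset_normFibre L (qsForm L) v x
  obtain ⟨q₁, hq₁, -⟩ := hQexh q₀ hq₀ hq₀x
  have hQne : Q.Nonempty := ⟨q₁, hq₁⟩
  have hQinj : ∀ q ∈ Q, ∀ q' ∈ Q, IsLocalStablyConjH L v q q' → q = q' := fun q hq q' hq' h => by
    by_contra hne; exact hQpair q hq q' hq' hne h
  -- stable conjugacy, `G`-regularity-with-compact-centraliser, norm pairs: the (N5) axioms at the datum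
  have hreg' : ∀ a b : ((UnitaryGroup.cmDatum L 2 (Matrix.of fun i j : Fin 2 => if i.val + j.val + 1 = 2 then (1 : L) else 0)).Local v × (UnitaryGroup.cmDatum L 1 (Matrix.of fun i j : Fin 1 => if i.val + j.val + 1 = 1 then (1 : L) else 0)).Local v), IsLocalStablyConjH L v a b →
      (IsLocalGRegular L v a ∧ IsCompact ((Subgroup.centralizer ({a} : Set ((UnitaryGroup.cmDatum L 2 (Matrix.of fun i j : Fin 2 => if i.val + j.val + 1 = 2 then (1 : L) else 0)).Local v × (UnitaryGroup.cmDatum L 1 (Matrix.of fun i j : Fin 1 => if i.val + j.val + 1 = 1 then (1 : L) else 0)).Local v)) : Subgroup ((UnitaryGroup.cmDatum L 2 (Matrix.of fun i j : Fin 2 => if i.val + j.val + 1 = 2 then (1 : L) else 0)).Local v × (UnitaryGroup.cmDatum L 1 (Matrix.of fun i j : Fin 1 => if i.val + j.val + 1 = 1 then (1 : L) else 0)).Local v)) : Set ((UnitaryGroup.cmDatum L 2 (Matrix.of fun i j : Fin 2 => if i.val + j.val + 1 = 2 then (1 : L) else 0)).Local v × (UnitaryGroup.cmDatum L 1 (Matrix.of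 fun i j : Fin 1 => if i.val + j.val + 1 = 1 then (1 : L) else 0)).Local v))) →
      (IsLocalGRegular L v b ∧ IsCompact ((Subgroup.centralizer ({b} : Set ((UnitaryGroup.cmDatum L 2 (Matrix.of fun i j : Fin 2 => if i.val + j.val + 1 = 2 then (1 : L) else 0)).Local v × (UnitaryGroup.cmDatum L 1 (Matrix.of fun i j : Fin 1 => if i.val + j.val + 1 = 1 then (1 : L) else 0)).Local v)) : Subgroup ((UnitaryGroup.cmDatum L 2 (Matrix.of fun i j : Fin 2 => if i.val + j.val + 1 = 2 then (1 : L) else 0)).Local v × (UnitaryGroup.cmDatum L 1 (Matrix.of fun i j : Fin 1 => if i.val + j.val + 1 = 1 then (1 : L) else 0)).Local v)) : Set ((UnitaryGroup.cmDatum L 2 (Matrix.of fun i j : Fin 2 => if i.val + j.val + 1 = 2 then (1 : L) else 0)).Local v × (UnitaryGroup.cmDatum L 1 (Matrix.of fun i j : Fin 1 => if i.val + j.val + 1 = 1 then (1 : L) else 0)).Local v))) :=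
    fun a b h ha => ⟨isLocalGRegular_of_isLocalStablyConjH L v ha.1 h, isCompact_centralizer_of_isLocalStablyConjH L v ha.1 ha.2 h⟩
  have hRst : ∀ (a b : ((UnitaryGroup.cmDatum L 2 (Matrix.of fun i j : Fin 2 => if i.val + j.val + 1 = 2 then (1 : L) else 0)).Local v × (UnitaryGroup.cmDatum L 1 (Matrix.of fun i j : Fin 1 => if i.val + j.val + 1 = 1 then (1 : L) else 0)).Local v)) (g' : Gqs L v), IsLocalStablyConjH L v a b → IsLocalNormPair L (qsForm L) v a g' → IsLocalNormPair L (qsForm L) v b g' :=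
    fun a b g' h hR => (isLocalNormPair_iff_of_isLocalStablyConjH L v (qsForm L) h g').2 hR
  -- compactness of the centraliser of every `G`-regular `a ∈ T ∈ SH`
  have hcptT : ∀ T ∈ SH, ∀ a ∈ T, IsLocalGRegular L v a → IsCompact ((Subgroup.centralizer ({a} : Set ((UnitaryGroup.cmDatum L 2 (Matrix.of fun i j : Fin 2 => if i.val + j.val + 1 = 2 then (1 : L) else 0)).Local v × (UnitaryGroup.cmDatum L 1 (Matrix.of fun i j : Fin 1 => if i.val + j.val + 1 = 1 then (1 : L) else 0)).Local v)) : Subgroup ((UnitaryGroup.cmDatum L 2 (Matrix.of fun i j : Fin 2 => if i.val + j.val + 1 = 2 then (1 : L) else 0)).Local v × (UnitaryGroup.cmDatum L 1 (Matrix.of fun i j : Fin 1 => if i.val + j.val + 1 = 1 then (1 : L) else 0)).Local v)) : Set ((UnitaryGroup.cmDatum L 2 (Matrix.of fun i j : Fin 2 => if i.val + j.val + 1 = 2 then (1 : L) else 0)).Local v × (UnitaryGroup.cmDatum L 1 (Matrix.of fun i j : Fin 1 => if i.val + j.val + 1 = 1 then (1 : L) else 0)).Local v)) := by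
    intro T hT a haT hareg
    obtain ⟨γ₀, hγ₀, hTeq⟩ := hZ T hT
    have h1 := F0P3cStCharTSUpTrCartanFields.centralizer_eq_of_mem_centralizer_of_isLocalGRegular L v hγ₀ (hTeq ▸ haT) hareg
    rw [h1, ← hTeq]; exact hKH T hT
  -- ★ (E0-count)
  have key := Literature.GroupTheory.StableFibre.weighted_fibre_card_eq_one (G := Gqs L v)
    (IsLocalStablyConjH L v) (fun a => IsStablyConjH.refl _ _ _ a) (fun a b h => h.symm) (fun a b c h h' => h.trans h')
    (fun a b h => isStablyConjH_of_isConj h)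
    (fun a => IsLocalGRegular L v a ∧ IsCompact ((Subgroup.centralizer ({a} : Set ((UnitaryGroup.cmDatum L 2 (Matrix.of fun i j : Fin 2 => if i.val + j.val + 1 = 2 then (1 : L) else 0)).Local v × (UnitaryGroup.cmDatum L 1 (Matrix.of fun i j : Fin 1 => if i.val + j.val + 1 = 1 then (1 : L) else 0)).Local v)) : Subgroup ((UnitaryGroup.cmDatum L 2 (Matrix.of fun i j : Fin 2 => if i.val + j.val + 1 = 2 then (1 : L) else 0)).Local v × (UnitaryGroup.cmDatum L 1 (Matrix.of fun i j : Fin 1 => if i.val + j.val + 1 = 1 then (1 : L) else 0)).Local v)) : Set ((UnitaryGroup.cmDatum L 2 (Matrix.of fun i j : Fin 2 => if i.val + j.val + 1 = 2 then (1 : L) else 0)).Local v × (UnitaryGroup.cmDatum L 1 (Matrix.of fun i j : Fin 1 => if i.val + j.val + 1 = 1 then (1 : L) else 0)).Local v))) hreg'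
    (fun a g' => IsLocalNormPair L (qsForm L) v a g') hRst (fun a g₁ g₂ hg hR => isLocalNormPair_of_isConj_right L v a hg hR)
    SH (fun T => (T.subgroupOf (Subgroup.normalizer (T : Set ((UnitaryGroup.cmDatum L 2 (Matrix.of fun i j : Fin 2 => if i.val + j.val + 1 = 2 then (1 : L) else 0)).Local v × (UnitaryGroup.cmDatum L 1 (Matrix.of fun i j : Fin 1 => if i.val + j.val + 1 = 1 then (1 : L) else 0)).Local v)))).index) m n ψ
    (fun h hh => hcomplete h hh.1 hh.2)
    (fun T hT T' hT' s hs s' hs' hsreg hconj => hirred T hT T' hT' s hs s' hs' hsreg.1 hconj)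
    (fun T hT s hs hsreg => by
      obtain ⟨γ₀, hγ₀, hTeq⟩ := hZ T hT
      exact exists_finset_mem_isConj_card_eq_index_centralizerH L v hns hγ₀ hTeq hs hsreg.1)
    (fun T hT s hs hsreg => hclasses T hT s hs hsreg.1)
    (fun T hT i s hs hsreg => hψR T hT i s hs hsreg.1)
    (fun T hT s hs hsreg g' hR => hψuniq T hT s hs hsreg.1 g' hR)
    x Q (fun q hq => ⟨⟨(hQ q hq).1, isCompact_centralizer_of_isLocalNormPair L v (hQ q hq).1 (hQ q hq).2 hxc⟩, (hQ q hq).2⟩) hQinj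
    (fun a ha hR => hQexh a ha.1 hR) hQne (fib x)
    (fun T hT i a => by
      rw [hfib x T hT i a]
      constructor
      · rintro ⟨haT, hareg, hconj⟩; exact ⟨haT, ⟨hareg, hcptT T hT a haT hareg⟩, hconj⟩
      · rintro ⟨haT, ⟨hareg, -⟩, hconj⟩; exact ⟨haT, hareg, hconj⟩)
    cQ
    (fun T hT i hne => by
      obtain ⟨a, ha⟩ := hne
      obtain ⟨haT, hareg, hconj⟩ := (hfib x T hT i a).1 ha
      obtain ⟨Q', hQ', hQ'inj, hQ'exh, hcard⟩ := hcQ T hT i ⟨a, haT⟩ hareg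
      -- the fibre of `eT T i ⟨a, _⟩ = ψ T i a ∼ x` IS the fibre of `x`
      have he : ψ T i a = ((eT T i ⟨a, haT⟩ : ↥(Subgroup.centralizer ({γc T i} : Set (Gqs L v)))) : Gqs L v) := hψ T hT i ⟨a, haT⟩
      have hconj' : IsConj ((eT T i ⟨a, haT⟩ : ↥(Subgroup.centralizer ({γc T i} : Set (Gqs L v)))) : Gqs L v) x := he ▸ hconj
      rw [← hcard]
      exact card_eq_of_normFibre_transversals L v (fun q hq => ⟨(hQ' q hq).1, isLocalNormPair_of_isConj_right L v q hconj' (hQ' q hq).2⟩) hQ'inj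
        (fun b hb hR => hQ'exh b hb (isLocalNormPair_of_isConj_right L v b hconj'.symm hR)) hQ hQinj hQexh)
  -- read the (N5) fibre count as the (E0a) count
  rw [← key]
  refine Finset.sum_congr rfl fun T hT => ?_
  congr 1
  refine Finset.sum_congr rfl fun i _ => ?_
  rw [ncard_eq_card_fib L v SH n γc eT heT ψ hψ fib hfib hT i x hx]

omit [MeasurableSpace (Gqs L v)] [BorelSpace (Gqs L v)] [LocallyCompactSpace (Gqs L v)] [SecondCountableTopology (Gqs L v)] [T2Space (Gqs L v)]
  [IsTopologicalGroup (Gqs L v)] [MeasurableSpace ((UnitaryGroup.cmDatum L 2 (Matrix.of fun i j : Fin 2 => if i.val + j.val + 1 = 2 then (1 : L) else 0)).Local v × (UnitaryGroup.cmDatum L 1 (Matrix.of fun i j : Fin 1 => if i.val + j.val + 1 = 1 then (1 : L) else 0)).Local v)] [BorelSpace ((UnitaryGroup.cmDatum L 2 (Matrix.of fun i j : Fin 2 => if i.val + j.val + 1 = 2 then (1 : L) else 0)).Local v × (UnitaryGroup.cmDatum L 1 (Matrix.of fun i j : Fin 1 => if i.val + j.val + 1 = 1 then (1 : L) else 0)).Local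 v)] in
include hns heT hψ hfib hZ hKH hcomplete hirred hclasses hψR hψuniq hcQ hΦ0 in
/-- **THE POINTWISE DENSITY** on an element `x` whose centraliser is compact if `x` is regular (every point of an elliptic torus):
`Φ x = Σ_{T ∈ SH} ([N_H(T):T])⁻¹ (m T)⁻¹ (cQ T)⁻¹ · Σ_i #{s ∈ T ∣ eT T i s ∼ x} · Φ x`. [cite: Rogawski1990, §12.5 pp. 182–184] -/
theorem apply_eq_sum_weight_mul_sum_ncard_mul (x : Gqs L v)
    (hxc : IsRegularElt (x.val : GL (Fin 3) (UnitaryGroup.LocalRing L v)) → IsCompact ((Subgroup.centralizer ({x} : Set (Gqs L v)) : Subgroup (Gqs L v)) : Set (Gqs L v))) :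
    Φ x = ∑ T ∈ SH, ((((T.subgroupOf (Subgroup.normalizer (T : Set ((UnitaryGroup.cmDatum L 2 (Matrix.of fun i j : Fin 2 => if i.val + j.val + 1 = 2 then (1 : L) else 0)).Local v × (UnitaryGroup.cmDatum L 1 (Matrix.of fun i j : Fin 1 => if i.val + j.val + 1 = 1 then (1 : L) else 0)).Local v)))).index : ℂ))⁻¹ * ((m T : ℂ))⁻¹ * ((cQ T : ℂ))⁻¹) * ∑ i : Fin (n T), ((({s : ↥T | IsConj ((eT T i s : ↥(Subgroup.centralizer ({γc T i} : Set (Gqs L v)))) : Gqs L v) x}.ncard : ℂ)) * Φ x) := by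
  by_cases hmatch : ∃ q : ((UnitaryGroup.cmDatum L 2 (Matrix.of fun i j : Fin 2 => if i.val + j.val + 1 = 2 then (1 : L) else 0)).Local v × (UnitaryGroup.cmDatum L 1 (Matrix.of fun i j : Fin 1 => if i.val + j.val + 1 = 1 then (1 : L) else 0)).Local v), IsLocalGRegular L v q ∧ IsLocalNormPair L (qsForm L) v q x
  · obtain ⟨q₀, hq₀, hq₀x⟩ := hmatch
    have hx : IsRegularElt (x.val : GL (Fin 3) (UnitaryGroup.LocalRing L v)) := (isLocalGRegular_iff_isRegularElt_of_isLocalNormPair L v hq₀x).1 hq₀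
    have h1 := sum_weight_mul_sum_ncard_eq_one L v hns SH n γc eT heT ψ hψ fib hfib hZ hKH hcomplete hirred m hclasses hψR hψuniq cQ hcQ x hx (hxc hx) ⟨q₀, hq₀, hq₀x⟩
    calc Φ x = (∑ T ∈ SH, ((((T.subgroupOf (Subgroup.normalizer (T : Set ((UnitaryGroup.cmDatum L 2 (Matrix.of fun i j : Fin 2 => if i.val + j.val + 1 = 2 then (1 : L) else 0)).Local v × (UnitaryGroup.cmDatum L 1 (Matrix.of fun i j : Fin 1 => if i.val + j.val + 1 = 1 then (1 : L) else 0)).Local v)))).index : ℂ))⁻¹ * ((m T : ℂ))⁻¹ * ((cQ T : ℂ))⁻¹) * ∑ i : Fin (n T), (({s : ↥T | IsConj ((eT T i s : ↥(Subgroup.centralizer ({γc T i} : Set (Gqs L v)))) : Gqs L v) x}.ncard : ℂ))) * Φ x := by rw [h1, one_mul]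
      _ = _ := by
        rw [Finset.sum_mul]
        refine Finset.sum_congr rfl fun T _ => ?_
        rw [mul_assoc, Finset.sum_mul]
  · rw [hΦ0 x hmatch]
    simp only [mul_zero, Finset.sum_const_zero]

/-! ## §3 The head and its transport companion -/

omit [BorelSpace (Gqs L v)] [LocallyCompactSpace (Gqs L v)] [SecondCountableTopology (Gqs L v)] [T2Space (Gqs L v)]
  [IsTopologicalGroup (Gqs L v)] [MeasurableSpace ((UnitaryGroup.cmDatum L 2 (Matrix.of fun i j : Fin 2 => if i.val + j.val + 1 = 2 then (1 : L) else 0)).Local v × (UnitaryGroup.cmDatum L 1 (Matrix.of fun i j : Fin 1 => if i.val + j.val + 1 = 1 then (1 : L) else 0)).Local v)] [BorelSpace ((UnitaryGroup.cmDatum L 2 (Matrix.of fun i j : Fin 2 => if i.val + j.val + 1 = 2 then (1 : L) else 0)).Local v × (UnitaryGroup.cmDatum L 1 (Matrix.of fun i j : Fin 1 => if i.val + j.val + 1 = 1 then (1 : L) else 0)).Local v)] in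
include hγc hcartO hncG hcovE hΦ0 hΦi in
/-- **Each `(T, i)`-piece `x ↦ #{s ∣ eT T i s ∼ x} · Φ x` is integrable on every `T′ ∈ Sell`**: it is a CONSTANT multiple of `Φ` there (`[N_G(T′):T′] · Φ` on the member the
embedding lands in, `0` on the others — ★ (E0a) §2). [cite: Rogawski1990, §12.5 p. 182] -/
theorem integrable_ncard_mul {T' : Subgroup (Gqs L v)} (hT' : T' ∈ Sell) {T : Subgroup ((UnitaryGroup.cmDatum L 2 (Matrix.of fun i j : Fin 2 => if i.val + j.val + 1 = 2 then (1 : L) else 0)).Local v × (UnitaryGroup.cmDatum L 1 (Matrix.of fun i j : Fin 1 => if i.val + j.val + 1 = 1 then (1 : L) else 0)).Local v)} (hT : T ∈ SH) (i : Fin (n T)) :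
    Integrable (fun x : ↥T' => (({s : ↥T | IsConj ((eT T i s : ↥(Subgroup.centralizer ({γc T i} : Set (Gqs L v)))) : Gqs L v) (x : Gqs L v)}.ncard : ℂ)) * Φ (x : Gqs L v)) (μTf T') := by
  obtain ⟨T₀, hT₀, y, hy⟩ := hcovE T hT i
  obtain ⟨-, γ₀', hγ₀', hT'eq⟩ := hcartO T' hT'
  have hΦ0' := apply_eq_zero_of_not_isRegularElt L v Φ hΦ0
  by_cases hTT : T' = T₀
  · subst hTT
    have hpt : ∀ x : ↥T', (({s : ↥T | IsConj ((eT T i s : ↥(Subgroup.centralizer ({γc T i} : Set (Gqs L v)))) : Gqs L v) (x : Gqs L v)}.ncard : ℂ)) * Φ (x : Gqs L v) =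
        (((T'.subgroupOf (Subgroup.normalizer (T' : Set (Gqs L v)))).index : ℂ)) * Φ (x : Gqs L v) := by
      intro x
      by_cases hx : IsRegularElt (((x : Gqs L v)).val : GL (Fin 3) (UnitaryGroup.LocalRing L v))
      · rw [ncard_setOf_isConj_apply_eq_index L v T (eT T i) y hy hγ₀' hT'eq x hx]
      · rw [hΦ0' _ hx, mul_zero, mul_zero]
    exact ((hΦi T' hT').const_mul (((T'.subgroupOf (Subgroup.normalizer (T' : Set (Gqs L v)))).index : ℂ))).congr
      (ae_of_all _ fun x => (hpt x).symm)
  · have hpt : ∀ x : ↥T', (({s : ↥T | IsConj ((eT T i s : ↥(Subgroup.centralizer ({γc T i} : Set (Gqs L v)))) : Gqs L v) (x : Gqs L v)}.ncard : ℂ)) * Φ (x : Gqs L v) = 0 := by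
      intro x
      by_cases hx : IsRegularElt (((x : Gqs L v)).val : GL (Fin 3) (UnitaryGroup.LocalRing L v))
      · rw [ncard_setOf_isConj_apply_eq_zero_of_ne L v T (hγc T hT i) (eT T i) y hy hγ₀' hT'eq (hncG T₀ hT₀ T' hT' (Ne.symm hTT)) x hx,
          Nat.cast_zero, zero_mul]
      · rw [hΦ0' _ hx, mul_zero]
    exact (integrable_zero _ _ _).congr (ae_of_all _ fun x => (hpt x).symm)


include hns hγc heT hψ hfib htH hZ hKH hcomplete hirred hclasses hψR hψuniq hcQ hcartO hncG hHaarGO hcoreGO hcovE hΦc hΦ0 hΦi in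
/-- **(E0) «G-REGROUP».**  The elliptic torus sum of a class function, re-parametrised by the compact `H_v`-Cartan system and the embedding family:
`Σ_{T′ ∈ Sell} ([N_G(T′):T′])⁻¹ ∫_{T′} Φ dμTf T′ = Σ_{T ∈ SH} ([N_H(T):T])⁻¹ (m T)⁻¹ (cQ T)⁻¹ Σ_i ∫_{s ∈ T, G-regular} Φ(eT T i s) dtH T` — the pointwise density (§2), a
finite-sum exchange, and ★ (E0a) TORUS EXCHANGE per `(T, i)`.  [cite: Rogawski1990, §12.5 pp. 182–184; Prop. 12.5.2 p. 185] [cite: LanglandsShelstad1987, §1.3]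
[cite: HarishChandra1970, Part V §4 Lemma 42] -/
theorem ellipticTorusSum_eq_weightedSum_embedding :
    ∑ T' ∈ Sell, (((T'.subgroupOf (Subgroup.normalizer (T' : Set (Gqs L v)))).index : ℂ))⁻¹ * ∫ x : ↥T', Φ (x : Gqs L v) ∂(μTf T') =
      ∑ T ∈ SH, ((((T.subgroupOf (Subgroup.normalizer (T : Set ((UnitaryGroup.cmDatum L 2 (Matrix.of fun i j : Fin 2 => if i.val + j.val + 1 = 2 then (1 : L) else 0)).Local v × (UnitaryGroup.cmDatum L 1 (Matrix.of fun i j : Fin 1 => if i.val + j.val + 1 = 1 then (1 : L) else 0)).Local v)))).index : ℂ))⁻¹ * ((m T : ℂ))⁻¹ * ((cQ T : ℂ))⁻¹) *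
        ∑ i : Fin (n T), ∫ s in {s : ↥T | IsLocalGRegular L v (s : ((UnitaryGroup.cmDatum L 2 (Matrix.of fun i j : Fin 2 => if i.val + j.val + 1 = 2 then (1 : L) else 0)).Local v × (UnitaryGroup.cmDatum L 1 (Matrix.of fun i j : Fin 1 => if i.val + j.val + 1 = 1 then (1 : L) else 0)).Local v))}, Φ ((eT T i s : ↥(Subgroup.centralizer ({γc T i} : Set (Gqs L v)))) : Gqs L v) ∂(tH T) := by
  have hΦ0' := apply_eq_zero_of_not_isRegularElt L v Φ hΦ0
  -- Step 1: inside each `∫_{T′}`, the pointwise density and the exchange of the finite sums with the integral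
  have hstep : ∀ T' ∈ Sell, ∫ x : ↥T', Φ (x : Gqs L v) ∂(μTf T') =
      ∑ T ∈ SH, ((((T.subgroupOf (Subgroup.normalizer (T : Set ((UnitaryGroup.cmDatum L 2 (Matrix.of fun i j : Fin 2 => if i.val + j.val + 1 = 2 then (1 : L) else 0)).Local v × (UnitaryGroup.cmDatum L 1 (Matrix.of fun i j : Fin 1 => if i.val + j.val + 1 = 1 then (1 : L) else 0)).Local v)))).index : ℂ))⁻¹ * ((m T : ℂ))⁻¹ * ((cQ T : ℂ))⁻¹) * ∑ i : Fin (n T), ∫ x : ↥T', (({s : ↥T | IsConj ((eT T i s : ↥(Subgroup.centralizer ({γc T i} : Set (Gqs L v)))) : Gqs L v) ((x : ↥T') : Gqs L v)}.ncard : ℂ)) * Φ ((x : ↥T') : Gqs L v) ∂(μTf T') := by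
    intro T' hT'
    obtain ⟨hT'c, γ₀', hγ₀', hT'eq⟩ := hcartO T' hT'
    have hpt : ∀ x : ↥T', Φ (x : Gqs L v) = ∑ T ∈ SH, ((((T.subgroupOf (Subgroup.normalizer (T : Set ((UnitaryGroup.cmDatum L 2 (Matrix.of fun i j : Fin 2 => if i.val + j.val + 1 = 2 then (1 : L) else 0)).Local v × (UnitaryGroup.cmDatum L 1 (Matrix.of fun i j : Fin 1 => if i.val + j.val + 1 = 1 then (1 : L) else 0)).Local v)))).index : ℂ))⁻¹ * ((m T : ℂ))⁻¹ * ((cQ T : ℂ))⁻¹) * ∑ i : Fin (n T), ((({s : ↥T | IsConj ((eT T i s : ↥(Subgroup.centralizer ({γc T i} : Set (Gqs L v)))) : Gqs L v) ((x : ↥T') : Gqs L v)}.ncard : ℂ)) * Φ ((x : ↥T') : Gqs L v)) :=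
      fun x => apply_eq_sum_weight_mul_sum_ncard_mul L v hns SH n γc eT heT ψ hψ fib hfib hZ hKH hcomplete hirred m hclasses hψR hψuniq cQ hcQ Φ hΦ0
        (x : Gqs L v) (fun hx => by rw [centralizer_eq_cartan_of_isRegularElt hγ₀' hT'eq x hx]; exact hT'c)
    have hI : ∀ T ∈ SH, ∀ i : Fin (n T), Integrable (fun x : ↥T' => (({s : ↥T | IsConj ((eT T i s : ↥(Subgroup.centralizer ({γc T i} : Set (Gqs L v)))) : Gqs L v) ((x : ↥T') : Gqs L v)}.ncard : ℂ)) * Φ ((x : ↥T') : Gqs L v)) (μTf T') :=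
      fun T hT i => integrable_ncard_mul L v SH n γc hγc eT Sell μTf hcartO hncG hcovE Φ hΦ0 hΦi hT' hT i
    rw [integral_congr_ae (ae_of_all _ hpt),
      integral_finsetSum _ (fun T hT => (integrable_finsetSum _ fun i _ => hI T hT i).const_mul _)]
    refine Finset.sum_congr rfl fun T hT => ?_
    rw [integral_const_mul, integral_finsetSum _ (fun i _ => hI T hT i)]
  -- Step 2: the algebra of the finite sums and ★ (E0a) per `(T, i)`
  calc ∑ T' ∈ Sell, (((T'.subgroupOf (Subgroup.normalizer (T' : Set (Gqs L v)))).index : ℂ))⁻¹ * ∫ x : ↥T', Φ (x : Gqs L v) ∂(μTf T')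
      = ∑ T' ∈ Sell, ∑ T ∈ SH, ∑ i : Fin (n T), ((((T.subgroupOf (Subgroup.normalizer (T : Set ((UnitaryGroup.cmDatum L 2 (Matrix.of fun i j : Fin 2 => if i.val + j.val + 1 = 2 then (1 : L) else 0)).Local v × (UnitaryGroup.cmDatum L 1 (Matrix.of fun i j : Fin 1 => if i.val + j.val + 1 = 1 then (1 : L) else 0)).Local v)))).index : ℂ))⁻¹ * ((m T : ℂ))⁻¹ * ((cQ T : ℂ))⁻¹) * ((((T'.subgroupOf (Subgroup.normalizer (T' : Set (Gqs L v)))).index : ℂ))⁻¹ * ∫ x : ↥T', (({s : ↥T | IsConj ((eT T i s : ↥(Subgroup.centralizer ({γc T i} : Set (Gqs L v)))) : Gqs L v) ((x : ↥T') : Gqs L v)}.ncard : ℂ)) * Φ ((x : ↥T') : Gqs L v) ∂(μTf T')) := by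
        refine Finset.sum_congr rfl fun T' hT' => ?_
        rw [hstep T' hT', Finset.mul_sum]
        refine Finset.sum_congr rfl fun T _ => ?_
        rw [Finset.mul_sum, Finset.mul_sum]
        refine Finset.sum_congr rfl fun i _ => ?_
        ring
    _ = ∑ T ∈ SH, ∑ T' ∈ Sell, ∑ i : Fin (n T), ((((T.subgroupOf (Subgroup.normalizer (T : Set ((UnitaryGroup.cmDatum L 2 (Matrix.of fun i j : Fin 2 => if i.val + j.val + 1 = 2 then (1 : L) else 0)).Local v × (UnitaryGroup.cmDatum L 1 (Matrix.of fun i j : Fin 1 => if i.val + j.val + 1 = 1 then (1 : L) else 0)).Local v)))).index : ℂ))⁻¹ * ((m T : ℂ))⁻¹ * ((cQ T : ℂ))⁻¹) * ((((T'.subgroupOf (Subgroup.normalizer (T' : Set (Gqs L v)))).index : ℂ))⁻¹ * ∫ x : ↥T', (({s : ↥T | IsConj ((eT T i s : ↥(Subgroup.centralizer ({γc T i} : Set (Gqs L v)))) : Gqs L v) ((x : ↥T') : Gqs L v)}.ncard : ℂ)) * Φ ((x : ↥T') : Gqs L v) ∂(μTf T')) := Finset.sum_comm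
    _ = ∑ T ∈ SH, ((((T.subgroupOf (Subgroup.normalizer (T : Set ((UnitaryGroup.cmDatum L 2 (Matrix.of fun i j : Fin 2 => if i.val + j.val + 1 = 2 then (1 : L) else 0)).Local v × (UnitaryGroup.cmDatum L 1 (Matrix.of fun i j : Fin 1 => if i.val + j.val + 1 = 1 then (1 : L) else 0)).Local v)))).index : ℂ))⁻¹ * ((m T : ℂ))⁻¹ * ((cQ T : ℂ))⁻¹) * ∑ i : Fin (n T), ∑ T' ∈ Sell, (((T'.subgroupOf (Subgroup.normalizer (T' : Set (Gqs L v)))).index : ℂ))⁻¹ * ∫ x : ↥T', (({s : ↥T | IsConj ((eT T i s : ↥(Subgroup.centralizer ({γc T i} : Set (Gqs L v)))) : Gqs L v) ((x : ↥T') : Gqs L v)}.ncard : ℂ)) * Φ ((x : ↥T') : Gqs L v) ∂(μTf T') := by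
        refine Finset.sum_congr rfl fun T _ => ?_
        rw [Finset.sum_comm, Finset.mul_sum]
        refine Finset.sum_congr rfl fun i _ => ?_
        rw [Finset.mul_sum]
    _ = ∑ T ∈ SH, ((((T.subgroupOf (Subgroup.normalizer (T : Set ((UnitaryGroup.cmDatum L 2 (Matrix.of fun i j : Fin 2 => if i.val + j.val + 1 = 2 then (1 : L) else 0)).Local v × (UnitaryGroup.cmDatum L 1 (Matrix.of fun i j : Fin 1 => if i.val + j.val + 1 = 1 then (1 : L) else 0)).Local v)))).index : ℂ))⁻¹ * ((m T : ℂ))⁻¹ * ((cQ T : ℂ))⁻¹) * ∑ i : Fin (n T), ∫ s : ↥T, Φ ((eT T i s : ↥(Subgroup.centralizer ({γc T i} : Set (Gqs L v)))) : Gqs L v) ∂(tH T) := by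
        refine Finset.sum_congr rfl fun T hT => ?_
        congr 1
        refine Finset.sum_congr rfl fun i _ => ?_
        obtain ⟨T₀, hT₀, y, hy⟩ := hcovE T hT i
        exact sum_invIndex_mul_integral_ncard_mul_eq_integral_comp L v hns T (tH T) (htH T hT) Sell μTf hcartO hncG hHaarGO hcoreGO (hγc T hT i) (eT T i) hT₀ y hy Φ hΦc hΦ0'
    _ = _ := by
        refine Finset.sum_congr rfl fun T hT => ?_
        congr 1
        refine Finset.sum_congr rfl fun i _ => ?_
        refine (setIntegral_eq_integral_of_forall_compl_eq_zero fun s hs => hΦ0' _ fun hreg => hs ?_).symm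
        exact (isLocalGRegular_iff_isRegularElt_of_isLocalNormPair L v (heT T hT i s)).2 hreg

include htH hcartO hcoreGO hHaarGO hcovE hΦc hΦi in
/-- **(E0) TRANSPORT COMPANION**: each `Φ ∘ eT T i` is integrable on the `G`-regular part of `T` — DERIVED from the total integrand on the member `T₀ ∈ Sell` the embedding lands in,
by whole-measure transport along `s ↦ y⁻¹ (eT T i s) y : T ≃ₜ* T₀` (★ (A1′)-D) and conjugation invariance (fence (γ): never assumed). [cite: Rogawski1990, §12.5 p. 183] [cite: LanglandsShelstad1987, §1.3] -/
theorem integrableOn_comp_embedding {T : Subgroup ((UnitaryGroup.cmDatum L 2 (Matrix.of fun i j : Fin 2 => if i.val + j.val + 1 = 2 then (1 : L) else 0)).Local v × (UnitaryGroup.cmDatum L 1 (Matrix.of fun i j : Fin 1 => if i.val + j.val + 1 = 1 then (1 : L) else 0)).Local v)} (hT : T ∈ SH) (i : Fin (n T)) :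
    IntegrableOn (fun s : ↥T => Φ ((eT T i s : ↥(Subgroup.centralizer ({γc T i} : Set (Gqs L v)))) : Gqs L v)) {s : ↥T | IsLocalGRegular L v (s : ((UnitaryGroup.cmDatum L 2 (Matrix.of fun i j : Fin 2 => if i.val + j.val + 1 = 2 then (1 : L) else 0)).Local v × (UnitaryGroup.cmDatum L 1 (Matrix.of fun i j : Fin 1 => if i.val + j.val + 1 = 1 then (1 : L) else 0)).Local v))} (tH T) := by
  obtain ⟨T₀, hT₀, y, hy⟩ := hcovE T hT i
  obtain ⟨-, γ₀, hγ₀, hT₀eq⟩ := hcartO T₀ hT₀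
  haveI : (μTf T₀).IsHaarMeasure := hHaarGO T₀ hT₀
  obtain ⟨c, hc⟩ := exists_conj_continuousMulEquiv L v (Z := Subgroup.centralizer ({γc T i} : Set (Gqs L v))) y hy
  have hmap : Measure.map ((eT T i).trans c) (tH T) = μTf T₀ :=
    map_continuousMulEquiv_eq_of_apply_compactCore_eq_one L v T hT₀eq ((eT T i).trans c) (tH T) (htH T hT) (μTf T₀) (hcoreGO T₀ hT₀)
  have hint : Integrable (fun x : ↥T₀ => Φ (x : Gqs L v)) (Measure.map ((eT T i).trans c) (tH T)) := by
    rw [hmap]; exact hΦi T₀ hT₀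
  have hint' := (integrable_map_equiv ((eT T i).trans c).toHomeomorph.toMeasurableEquiv (fun x : ↥T₀ => Φ (x : Gqs L v))).1 hint
  have heq : (fun x : ↥T₀ => Φ (x : Gqs L v)) ∘ (((eT T i).trans c).toHomeomorph.toMeasurableEquiv) = fun s : ↥T => Φ ((eT T i s : ↥(Subgroup.centralizer ({γc T i} : Set (Gqs L v)))) : Gqs L v) := by
    funext s
    show Φ ((((eT T i).trans c) s : ↥T₀) : Gqs L v) = Φ ((eT T i s : ↥(Subgroup.centralizer ({γc T i} : Set (Gqs L v)))) : Gqs L v)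
    rw [ContinuousMulEquiv.trans_apply, hc]
    exact hΦc _ _ (isConj_iff.2 ⟨y, by group⟩)
  rw [heq] at hint'
  exact hint'.integrableOn

end Road

end Summit.HodgeConjecture.HodgeConjecture.Cruxes.H413.F0P3cStCharTSEllInnerGRegroup
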